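import Summits.KontsevichZagierPeriods.KontsevichZagierPeriods.Theses.IsogenyCertificates
import Summits.KontsevichZagierPeriods.KontsevichZagierPeriods.Theorems.SymplecticScissorsRealOnePeriodRelationsConditional
import Summits.KontsevichZagierPeriods.KontsevichZagierPeriods.Theorems.FermatIsogenyBetaLinearSectorGreen
import Literature.NumberTheory.Transcendental.CurvePeriods

/-!
# `GenusTwoRealPeriodCell` (stmt-KontsevichZagierPeriods-17657) from the Huber–Wüstholz theorem for
# curve-type periods — the crux CLOSED MODULO its declared transcendence input

Line `Sketch` (HW transport) of the crux `GenusTwoRealPeriodCell` (route `IsogenyCertificates`,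
rank 7: Conjecture 1 in kernel form on the sector of complete real half-periods
`[component of {F>0} ∋ q, (a₀+a₁x)/√F]` of genus-2 curves `y² = F(x)` over `ℚ`, `F` squarefree of
degree 5 or 6). Every generator of the sector is a ONE-dimensional representation, so the crux is the
genus-two layer of the sibling crux `RealOnePeriodRelations` (stmt-10042, "Huber–Wüstholz in real
clothes"), landed conditionally on the named fact `HuberWustholzCurvePeriods` as
`SymplecticScissors.RealOnePeriodRelations.realOnePeriodRelations_of_huberWustholzCurvePeriods`:
a vanishing combination of one-dimensional representations lies in `M₁ = closure (1a ∪ 1b ∪ 2 ∪ Green)`.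
The move content `M₁ ≤ KZ.relations` — i.e. the typed Green generator is a chain of moves 1a, 1b, 2, 3
(Newton–Leibniz down a band off a null set, twice, a swap, a reflection, rule 1b) — is now an
UNCONDITIONAL theorem of the tree (`FermatIsogeny.BetaLinearSector.M₁_le_relations`, assembled on
2026-08-17 from the Green stubs landed by the parallel leads of cruxes stmt-3897 and stmt-17657:
two-set adapted cylindrical decomposition, one Newton–Leibniz move per sub-band
(`GenusTwoRealPeriodCellLine.stub_subband`), the engine, Green-from-engine over the `PlanarAreas`
analytic stubs). Hence

`genusTwoRealPeriodCell_of_huberWustholzCurvePeriods : HuberWustholzCurvePeriods → GenusTwoRealPeriodCell`,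

the crux closed modulo exactly its declared transcendence input (Huber–Wüstholz 2022, Thm 13.3 (2):
all `ℚ̄`-linear relations among periods of curve type are induced by bilinearity and functoriality —
a cite-only named fact of the tree, the apex shared with cruxes 10042, 3897, RealArcKernel, KZDimTwo).
[cite: HuberWustholz2022, Thm 13.3 (2)] [cite: KontsevichZagier2001, §1.2]
-/

noncomputable section

open Literature.NumberTheory.Transcendental
open Summit.KontsevichZagierPeriods.SymplecticScissors.RealOnePeriodRelationsNegative (greenSet M₁ H₁ crux_iff)

namespace Summit.KontsevichZagierPeriods.IsogenyCertificates.GenusTwoRealPeriodCellLine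

/-- **The generators of the genus-two sector are one-dimensional**: the generating set of
`GenusTwoRealPeriodCell` lies in the range of `KZ.of` on `IntegralRep 1`, so its closure lies in `H₁`.
[cite: KontsevichZagier2001, §1.2] -/
theorem genusTwoGen_closure_le_H₁ :
    AddSubgroup.closure {d : KZ.FormalRep | ∃ (F : Polynomial ℚ) (q a₀ a₁ : ℚ) (r : KZ.IntegralRep 1),
      Squarefree F ∧ (F.natDegree = 5 ∨ F.natDegree = 6) ∧ 0 < Polynomial.aeval (q : ℝ) F ∧
      r.domain = {x | x 0 ∈ connectedComponentIn {y : ℝ | 0 < Polynomial.aeval y F} (q : ℝ)} ∧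
      Set.EqOn r.integrand (fun x => ((a₀ : ℝ) + (a₁ : ℝ) * x 0) / Real.sqrt (Polynomial.aeval (x 0) F))
        r.domain ∧ d = KZ.of r} ≤ H₁ := by
  refine AddSubgroup.closure_mono ?_
  rintro d ⟨F, q, a₀, a₁, r, -, -, -, -, -, rfl⟩
  exact ⟨r, rfl⟩

/-- **`RealOnePeriodRelations` puts every vanishing one-dimensional combination in `KZ.relations`**:
with `M₁ ≤ relations` (unconditional, `FermatIsogeny.BetaLinearSector.M₁_le_relations`), the sibling
crux (stmt-10042) is the kernel conjecture of the full calculus on the subgroup `H₁` generated by all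
one-dimensional representations. [cite: KontsevichZagier2001, §1.2] -/
theorem kernel_le_relations_of_realOnePeriodRelations
    (hR : Summit.KontsevichZagierPeriods.KontsevichZagierPeriods.Theses.SymplecticScissors.RealOnePeriodRelations)
    {c : KZ.FormalRep} (hc : c ∈ H₁) (h0 : KZ.eval c = 0) : c ∈ KZ.relations :=
  Summit.KontsevichZagierPeriods.FermatIsogeny.BetaLinearSector.M₁_le_relations ((crux_iff.mp hR) c hc h0)

/-- **The crux modulo its transcendence input**: the Huber–Wüstholz theorem for curve-type periods
(`HuberWustholzCurvePeriods`, Huber–Wüstholz 2022 Thm 13.3 (2), a named fact of the tree) implies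
`GenusTwoRealPeriodCell` — every value-0 formal `ℤ`-combination of complete real half-periods
`[component of {F>0} ∋ q, (a₀+a₁x)/√F]` of genus-2 curves over `ℚ` lies in `KZ.relations`. Proof:
the generators are one-dimensional (`genusTwoGen_closure_le_H₁`), so the combination lies in
`H₁ ∩ ker eval`, hence in `M₁` by `realOnePeriodRelations_of_huberWustholzCurvePeriods`, hence in
`KZ.relations` by `M₁ ≤ relations`. CONDITIONAL on the named fact only.
[cite: HuberWustholz2022, Thm 13.3 (2)] -/
theorem genusTwoRealPeriodCell_of_huberWustholzCurvePeriods
    (hHW : Literature.NumberTheory.Transcendental.HuberWustholzCurvePeriods) :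
    Summit.KontsevichZagierPeriods.KontsevichZagierPeriods.Theses.IsogenyCertificates.GenusTwoRealPeriodCell :=
  fun _ hc h0 => kernel_le_relations_of_realOnePeriodRelations
    (Summit.KontsevichZagierPeriods.SymplecticScissors.RealOnePeriodRelations.realOnePeriodRelations_of_huberWustholzCurvePeriods
      hHW) (genusTwoGen_closure_le_H₁ hc) h0

/-- **Equivalently: the crux follows from the sibling crux `RealOnePeriodRelations` (stmt-10042)
alone** — no Green hypothesis any more. [cite: KontsevichZagier2001, §1.2] -/
theorem genusTwoRealPeriodCell_of_realOnePeriodRelations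
    (hR : Summit.KontsevichZagierPeriods.KontsevichZagierPeriods.Theses.SymplecticScissors.RealOnePeriodRelations) :
    Summit.KontsevichZagierPeriods.KontsevichZagierPeriods.Theses.IsogenyCertificates.GenusTwoRealPeriodCell :=
  fun _ hc h0 => kernel_le_relations_of_realOnePeriodRelations hR (genusTwoGen_closure_le_H₁ hc) h0

end Summit.KontsevichZagierPeriods.IsogenyCertificates.GenusTwoRealPeriodCellLine

end
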